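import Summits.Ventures.HodgeRepro2.T5U11Product
import Summits.Ventures.HodgeRepro2.T5U11Center

/-!
# The kernel of `Circle × SU(1,1) → U(1,1)` is `{(1,1), (-1,-1)}`; the centre is the scalar circle

The multiplication map `mulHom : Circle × SU(1,1) →* U(1,1)` of `T5U11Product` is `2 : 1`:
its kernel is `{(1, 1), (-1, -1)}` (`λ·h = 1` forces `h = λ⁻¹·1`, so `λ⁻² = det h = 1`,
`λ = ±1` — `T5CentreU11.smul_one_det_one_iff`).  Together with `T5U11Center.mem_center_iff` this
identifies the centre `Z_j` of `U(1,1)` with the range of the scalar embedding `scalarHom`.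

Blind lane: Mathlib + own prefix only; no sorry; axioms ⊆ {propext, Classical.choice, Quot.sound}.
-/

namespace Summit.Ventures.HodgeRepro2.T5U11ProductKernel

open T5UnitaryBound T5U11Unimodular T5SU11Unimodular T5U11Product T5U11Center
open Matrix hiding J

/-- `-1 ∈ SU(1,1)`. -/
theorem neg_one_mem_SU11 : (-1 : SpecialLinearGroup (Fin 2) ℂ) ∈ SU11 := by
  rw [mem_SU11_iff, MemU11]
  have h : ((-1 : SpecialLinearGroup (Fin 2) ℂ) : Matrix (Fin 2) (Fin 2) ℂ) = -1 := rfl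
  rw [h, conjTranspose_neg, conjTranspose_one, Matrix.neg_mul, Matrix.one_mul, Matrix.mul_neg,
    Matrix.mul_one, neg_neg]

/-- `-1` as an element of `SU(1,1)`. -/
def negOne : SU11 := ⟨-1, neg_one_mem_SU11⟩

/-- The matrix of `negOne`. -/
@[simp] lemma coe_negOne :
    ((negOne : SpecialLinearGroup (Fin 2) ℂ) : Matrix (Fin 2) (Fin 2) ℂ) = -1 := rfl

/-- `-1` as an element of the circle. -/
def negOneCircle : Circle := ⟨-1, mem_sphere_zero_iff_norm.mpr (by simp)⟩

/-- The complex number of `negOneCircle`. -/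
@[simp] lemma coe_negOneCircle : ((negOneCircle : Circle) : ℂ) = -1 := rfl

/-- `mulHom (-1, -1) = 1`. -/
theorem mulHom_negOne : mulHom (negOneCircle, negOne) = 1 := by
  apply Subtype.ext
  apply Units.ext
  rw [coe_mulHom]
  simp

/-- **The kernel of `mulHom` is `{(1, 1), (-1, -1)}`**. -/
theorem mulHom_eq_one_iff (p : Circle × SU11) :
    mulHom p = 1 ↔ p = 1 ∨ p = (negOneCircle, negOne) := by
  constructor
  · intro hp
    have h := congr_arg (fun g : U11 => ((g : GL (Fin 2) ℂ) : Matrix (Fin 2) (Fin 2) ℂ)) hp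
    simp only [coe_mulHom, OneMemClass.coe_one, Units.val_one] at h
    -- `h : λ • h₂ = 1`, so `h₂ = λ⁻¹ • 1` and `det (λ⁻¹ • 1) = 1`
    have hlam : (p.1 : ℂ) ≠ 0 := coe_ne_zero p.1
    have h2 : ((p.2 : SpecialLinearGroup (Fin 2) ℂ) : Matrix (Fin 2) (Fin 2) ℂ) = (p.1 : ℂ)⁻¹ • 1 := by
      rw [← h, smul_smul, inv_mul_cancel₀ hlam, one_smul]
    have hdet : ((p.1 : ℂ)⁻¹ • (1 : Matrix (Fin 2) (Fin 2) ℂ)).det = 1 := by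
      rw [← h2]; exact Matrix.SpecialLinearGroup.det_coe _
    rcases T5CentreU11.smul_one_det_one_iff.mp hdet with h1 | h1
    · left
      have hl : p.1 = 1 := Circle.ext (by simpa using (inv_eq_one.mp h1))
      have hh : p.2 = 1 := by
        apply Subtype.ext; apply Subtype.ext
        rw [h2, h1, one_smul]; rfl
      exact Prod.ext hl hh
    · right
      have hl : p.1 = negOneCircle := Circle.ext (by
        rw [coe_negOneCircle]
        have : (p.1 : ℂ)⁻¹ = -1 := h1
        rw [← inv_inv (p.1 : ℂ), this]; norm_num)
      have hh : p.2 = negOne := by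
        apply Subtype.ext; apply Subtype.ext
        rw [h2, h1, coe_negOne, neg_one_smul]
      exact Prod.ext hl hh
  · rintro (rfl | rfl)
    · exact map_one mulHom
    · exact mulHom_negOne

/-- `(-1, -1)` has order two: the fibres of `mulHom` are the pairs `{p, p · (-1, -1)}`. -/
theorem mulHom_eq_iff (p q : Circle × SU11) :
    mulHom p = mulHom q ↔ q = p ∨ q = p * (negOneCircle, negOne) := by
  rw [← inv_mul_eq_one (a := mulHom p) (b := mulHom q), ← map_inv, ← map_mul, mulHom_eq_one_iff,
    inv_mul_eq_one, inv_mul_eq_iff_eq_mul]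
  constructor
  · rintro (h | h)
    · exact Or.inl h.symm
    · exact Or.inr h
  · rintro (h | h)
    · exact Or.inl h.symm
    · exact Or.inr h

/-- **The centre of `U(1,1)` is the range of the scalar embedding.** -/
theorem center_eq_range_scalarHom : Subgroup.center U11 = scalarHom.range := by
  ext z
  rw [mem_center_iff, MonoidHom.mem_range]
  constructor
  · rintro ⟨lam, hlam, hz⟩
    refine ⟨⟨lam, mem_sphere_zero_iff_norm.mpr ?_⟩, ?_⟩
    · exact (sq_eq_sq₀ (norm_nonneg _) zero_le_one).mp
        (by rw [← Complex.normSq_eq_norm_sq, hlam, one_pow])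
    · apply Subtype.ext; apply Units.ext
      rw [coe_scalarHom, hz]
  · rintro ⟨lam, rfl⟩
    exact ⟨lam, by rw [Complex.normSq_eq_norm_sq, Circle.norm_coe, one_pow], rfl⟩

/-- The element `ε = (-1, -1)` generating the kernel of `mulHom`. -/
def eps : Circle × SU11 := (negOneCircle, negOne)

/-- `ε² = 1`. -/
lemma eps_mul_eps : eps * eps = 1 := by
  apply Prod.ext
  · exact Circle.ext (by simp [eps, negOneCircle])
  · apply Subtype.ext
    show (-1 : SpecialLinearGroup (Fin 2) ℂ) * (-1) = 1
    rw [neg_one_mul, neg_neg]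

/-- `mulHom (p * ε) = mulHom p`. -/
lemma mulHom_mul_eps (p : Circle × SU11) : mulHom (p * eps) = mulHom p :=
  ((mulHom_eq_iff p (p * eps)).mpr (Or.inr rfl)).symm

/-- The saturation of a set under `mulHom`: `mulHom⁻¹ (mulHom '' A) = A ∪ A·ε`. -/
theorem preimage_image_mulHom (A : Set (Circle × SU11)) :
    mulHom ⁻¹' (mulHom '' A) = A ∪ (fun p => p * eps) ⁻¹' A := by
  ext p
  simp only [Set.mem_preimage, Set.mem_image, Set.mem_union]
  constructor
  · rintro ⟨a, ha, hap⟩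
    rcases (mulHom_eq_iff a p).mp hap with rfl | rfl
    · exact Or.inl ha
    · right
      show a * eps * eps ∈ A
      rw [mul_assoc, eps_mul_eps, mul_one]
      exact ha
  · rintro (hp | hp)
    · exact ⟨p, hp, rfl⟩
    · exact ⟨p * eps, hp, mulHom_mul_eps p⟩

section measure

open MeasureTheory MeasureTheory.Measure

variable [MeasurableSpace Circle] [BorelSpace Circle] [MeasurableSpace SU11] [BorelSpace SU11]
  [MeasurableSpace U11] [BorelSpace U11]

/-- **`mulHom` is `2 : 1` in measure**: on a compact set `A` on which `mulHom` is injective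
(`A ∩ A·ε = ∅`), the image measure of the product of Haar measures gives `mulHom '' A` twice the
product measure of `A` (right-invariance of `μC.prod μS` under `ε`: `Circle` is commutative and
`SU(1,1)` is unimodular). -/
theorem map_mulHom_prod_image (μC : Measure Circle) [IsHaarMeasure μC] (μS : Measure SU11)
    [IsHaarMeasure μS] {A : Set (Circle × SU11)} (hA : IsCompact A)
    (hdisj : ∀ p ∈ A, p * eps ∉ A) :
    map mulHom (μC.prod μS) (mulHom '' A) = 2 * (μC.prod μS) A := by
  haveI : IsMulRightInvariant μS := T5SU11Unimodular.isMulRightInvariant μS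
  have hmeasA : MeasurableSet A := hA.isClosed.measurableSet
  have himg : MeasurableSet (mulHom '' A) := (hA.image continuous_mulHom).isClosed.measurableSet
  rw [map_apply continuous_mulHom.measurable himg, preimage_image_mulHom]
  have hd : Disjoint A ((fun p => p * eps) ⁻¹' A) := by
    rw [Set.disjoint_left]
    intro p hp hp'
    exact hdisj p hp hp'
  rw [measure_union hd ((measurable_mul_const eps) hmeasA), measure_preimage_mul_right, two_mul]

/-- The same against a given Haar measure `μU` on `U(1,1)`: with `c = haarScalarFactor`,
`c · μU (mulHom '' A) = 2 · (μC.prod μS) A` — the «2 : 1» of `Z_j × SU(1,1) → U(1,1)` in measure. -/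
theorem haarScalarFactor_mul_measure_image (μC : Measure Circle) [IsHaarMeasure μC]
    (μS : Measure SU11) [IsHaarMeasure μS] (μU : Measure U11) [IsHaarMeasure μU]
    {A : Set (Circle × SU11)} (hA : IsCompact A) (hdisj : ∀ p ∈ A, p * eps ∉ A) :
    (haarScalarFactor (map mulHom (μC.prod μS)) μU : ENNReal) * μU (mulHom '' A) =
      2 * (μC.prod μS) A := by
  set c := haarScalarFactor (map mulHom (μC.prod μS)) μU with hc
  have h : map mulHom (μC.prod μS) = c • μU := map_mulHom_prod_eq_smul μC μS μU
  calc (c : ENNReal) * μU (mulHom '' A) = (c • μU) (mulHom '' A) := by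
        rw [Measure.smul_apply, ENNReal.smul_def, smul_eq_mul]
    _ = map mulHom (μC.prod μS) (mulHom '' A) := by rw [← h]
    _ = 2 * (μC.prod μS) A := map_mulHom_prod_image μC μS hA hdisj

end measure

end Summit.Ventures.HodgeRepro2.T5U11ProductKernel
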